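import Mathlib.Tactic.Linarith
import Summits.CriticalPhenomena.PercolationContinuityZ3.Theorems.PercNearOneGluingNoHeavyLowerTailSahiCTCLoopSplit
import Summits.CriticalPhenomena.PercolationContinuityZ3.Theorems.PercNearOneGluingNoHeavyLowerTailSahiCTCHarrisUpGround
import Summits.CriticalPhenomena.PercolationContinuityZ3.Theorems.PercNearOneGluingNoHeavyLowerTailSahiCTCNcPeel
import HarnessLib

/-!
# `NoHeavyLowerTail` (crux stmt-CriticalPhenomena-4575), P3 lane: THE CO-LEVEL-1 CASE OF THE COEFFICIENTWISE THRESHOLD CERTIFICATE,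
# EVERY GROUND SET — `M₁(𝒳,𝒵) ∈ ℕ[s]` for every pair of up-sets (the complement-dual of `Ñ_{k−1} ∈ ℕ[r]`, i.e. CTC_{k−1}(k) for every `k`)

Support file (seat `prim-l12-p3`, gen 24; `--supports stmt-CriticalPhenomena-4575`).  Memo
`run/shared/lean/prim/prim-l12/FROM-prim-l12-p3-g24-VALUE-LEVEL-TH2K.md` §3.  Companions: `…SahiCTCLoopSplit` (the loop dictionary and the
counting lemma), `…SahiCTCHarrisUpGround` (the relative Harris block for up-sets), `…SahiCTCNcGen` / `…SahiAllButC` (the generic certificate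
polynomial `Ñ_c` and the slot `Th_{k−c}^k`), `…SahiCTCNcSplit*` (g23).

In the complement-dual language of memo g23 §3 (up-sets `𝒳, 𝒵` of OPEN sets; `X₊ = GF(𝒳 ∖ {∅})`, `X₀ = GF(𝒳 ∩ {∅})`, `Y = 𝒳 ∩ 𝒵`,
`L` = common loops `{u : {u} ∈ 𝒳 ∩ 𝒵}`, `W_L = Σ_{u∈L} s_u`, `e₁`, `Π`) the level-`(k−1)` certificate polynomial `Ñ_{k−1}(K_𝒳, K_𝒵)` reads
  `M₁(𝒳,𝒵) = e₁(Π+1)(Π·Y₊ − X₊·Z₊) − (Π−1)·Π·W_L − e₁(X₊·Z₀ + X₀·Z₊) + e₁(Π−1)·X₀·Z₀`        (`M1`; `Θ_{k−1} ↔ Π − 1`, `D_{k−1} ↔ 1`).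
THIS FILE proves **`M₁(𝒳,𝒵) ∈ ℕ[s]` for every pair of up-sets of every finite type** (`coeff_M1_nonneg`; value form `eval_M1_nonneg`):
* `coeff_harris_sub_meets_nonneg` — the LOOP IDENTITY `Π·Y − X·Z − GF(meets L) = GF(meets L)·GF(N₀'∖{∅}) + [Π_{V∖L}·GF(X₀'∩Z₀') − X₀'·Z₀']`
  (up-sets `∌ ∅`), the bracket being the relative Harris block: "a common loop contributes Harris slack `Π − Π_{V∖L}` outright";
* `coeff_M1_nonneg_core` (`∅ ∉ 𝒳, 𝒵`: `M₁ = e₁(Π+1)·[loop identity] + e₁·GF(meets L) + Π·[counting lemma]`), `coeff_M1_nonneg_univ` (`𝒳 = 2^V`: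
  `M₁ = Π·(e₁·Z₊ − (Π−1)·W)`, LYM through the loops of `𝒵`), `M1_comm`, and the theorem.
The bridge to `Ngen (k−1) (cx 𝒳) (cx 𝒵)` (member-complementation reverses profiles, `n ↦ 4·𝟙 − n`) and the endpoint "ρ_{k−1} = μ(·|exactly one open)
certifies the slot `Th₁ᵏ` (at least one of `k` open) for every `k`" are left to the companion `…SahiCTCCoLevelOneBridge`.  Nothing is asserted about the crux.
-/

namespace Summit.CriticalPhenomena.PercolationContinuityZ3.Theorems.SahiCTCForms

open Finset MvPolynomial SahiCTCGenFun

variable {α : Type*} [DecidableEq α] [Fintype α]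

/-! ### The co-level-1 form -/

/-- **The co-level-1 form** (memo g24 §3; the complement-dual of `Ñ_{k−1}(K_𝒳,K_𝒵)`, i.e. the (TC) row of the certificate
`ρ_{k−1} = μ(· | exactly one open)` of the slot "at least one of `k` open", written on the up-sets `𝒳, 𝒵` of open sets):
`M₁ = e₁(Π+1)(Π·Y₊ − X₊Z₊) − (Π−1)Π·W_L − e₁(X₊Z₀ + X₀Z₊) + e₁(Π−1)X₀Z₀`. [this work] -/
noncomputable def M1 (𝒳 𝒵 : Finset (Finset α)) : MvPolynomial α ℤ :=
  ee 1 * (PiP + 1) * (PiP * gf ((𝒳 ∩ 𝒵).erase ∅) - gf (𝒳.erase ∅) * gf (𝒵.erase ∅))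
    - (PiP - 1) * PiP * gf (singles (loops 𝒳 𝒵))
    - ee 1 * (gf (𝒳.erase ∅) * gf (empPart 𝒵) + gf (empPart 𝒳) * gf (𝒵.erase ∅))
    + ee 1 * (PiP - 1) * gf (empPart 𝒳) * gf (empPart 𝒵)

/-- `M₁` is symmetric. [this work] -/
theorem M1_comm (𝒳 𝒵 : Finset (Finset α)) : M1 𝒳 𝒵 = M1 𝒵 𝒳 := by
  unfold M1; rw [loops_comm, inter_comm]; ring

omit [DecidableEq α] [Fintype α] in

/-! ### The core case `∅ ∉ 𝒳, 𝒵`: the Harris form dominates `GF(meets L)` -/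

omit [Fintype α] in
omit [Fintype α] in
/-- The intersection of two up-sets is an up-set. [this work] -/
theorem isUpperSet_inter' {𝒳 𝒵 : Finset (Finset α)} (h𝒳 : IsUpperSet (𝒳 : Set (Finset α))) (h𝒵 : IsUpperSet (𝒵 : Set (Finset α))) :
    IsUpperSet ((𝒳 ∩ 𝒵 : Finset (Finset α)) : Set (Finset α)) := by
  rw [coe_inter]; exact h𝒳.inter h𝒵

/-- **The loop identity and its consequence** (memo g24 §3(a),(b)): for up-sets `𝒳, 𝒵 ∌ ∅` with common loops `L`,
`Π·GF(𝒳∩𝒵) − GF(𝒳)·GF(𝒵) − GF(meets L) = GF(meets L)·GF(N₀' ∖ {∅}) + [GF(2^{V∖L})·GF(X₀ ∩ Z₀) − GF(X₀)·GF(Z₀)] ∈ ℕ[s]`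
(`X₀, Z₀` = members avoiding `L`, `N₀'` = sets avoiding `L` in neither family; the bracket is the relative Harris block). [this work] -/
theorem coeff_harris_sub_meets_nonneg {𝒳 𝒵 : Finset (Finset α)} (h𝒳 : IsUpperSet (𝒳 : Set (Finset α)))
    (h𝒵 : IsUpperSet (𝒵 : Set (Finset α))) (hX0 : ∅ ∉ 𝒳) (hZ0 : ∅ ∉ 𝒵) :
    ∀ n, 0 ≤ (PiP * gf (𝒳 ∩ 𝒵) - gf 𝒳 * gf 𝒵 - gf (meets (loops 𝒳 𝒵))).coeff n := by
  set L := loops 𝒳 𝒵 with hLdef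
  have hLX : ∀ u ∈ L, ({u} : Finset α) ∈ 𝒳 := fun u hu => singleton_mem_left_of_mem_loops hu
  have hLZ : ∀ u ∈ L, ({u} : Finset α) ∈ 𝒵 := fun u hu => singleton_mem_right_of_mem_loops hu
  have hY : IsUpperSet ((𝒳 ∩ 𝒵 : Finset (Finset α)) : Set (Finset α)) := isUpperSet_inter' h𝒳 h𝒵
  have hLY : ∀ u ∈ L, ({u} : Finset α) ∈ 𝒳 ∩ 𝒵 := fun u hu => mem_inter.2 ⟨hLX u hu, hLZ u hu⟩
  have eX := gf_eq_meets_add_avoid h𝒳 hLX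
  have eZ := gf_eq_meets_add_avoid h𝒵 hLZ
  have eY := gf_eq_meets_add_avoid hY hLY
  rw [avoid_inter] at eY
  have ePi := PiP_eq_meets_add (α := α) L
  have eC := gf_powerset_compl_eq L 𝒳 𝒵
  -- `∅ ∈ N₀'`
  set N₀ := ((univ \ L).powerset).filter fun S => S ∉ 𝒳 ∧ S ∉ 𝒵 with hN₀
  have h0N : (∅ : Finset α) ∈ N₀ := mem_filter.2 ⟨mem_powerset.2 (empty_subset _), hX0, hZ0⟩
  have eN : gf N₀ = gf (N₀.erase ∅) + 1 := by
    rw [← gf_singleton_empty, ← gf_union (disjoint_singleton_right.2 (notMem_erase ∅ _))]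
    congr 1; ext S; simp only [mem_union, mem_erase, mem_singleton]
    constructor
    · intro h; by_cases hS : S = ∅
      · exact Or.inr hS
      · exact Or.inl ⟨hS, h⟩
    · rintro (⟨_, h⟩ | rfl)
      · exact h
      · exact h0N
  have key : PiP * gf (𝒳 ∩ 𝒵) - gf 𝒳 * gf 𝒵 - gf (meets L) =
      gf (meets L) * gf (N₀.erase ∅) + (gf ((univ \ L).powerset) * gf (avoid L 𝒳 ∩ avoid L 𝒵) - gf (avoid L 𝒳) * gf (avoid L 𝒵)) := by
    rw [eY, eX, eZ, ePi, eC, eN]; ring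
  -- the relative Harris block on the ground set `V ∖ L`
  have hsubX : ∀ T ∈ avoid L 𝒳, T ⊆ univ \ L := fun T hT => (mem_filter.1 hT).2
  have hsubZ : ∀ T ∈ avoid L 𝒵, T ⊆ univ \ L := fun T hT => (mem_filter.1 hT).2
  have hupX : ∀ A ∈ avoid L 𝒳, ∀ B : Finset α, A ⊆ B → B ⊆ univ \ L → B ∈ avoid L 𝒳 :=
    fun A hA B hAB hB => mem_filter.2 ⟨h𝒳 hAB (mem_filter.1 hA).1, hB⟩
  have hupZ : ∀ A ∈ avoid L 𝒵, ∀ B : Finset α, A ⊆ B → B ⊆ univ \ L → B ∈ avoid L 𝒵 :=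
    fun A hA B hAB hB => mem_filter.2 ⟨h𝒵 hAB (mem_filter.1 hA).1, hB⟩
  intro n
  rw [key]
  exact cw_add (cw_mul (coeff_gf_nonneg _) (coeff_gf_nonneg _)) (coeff_harris_upIn_sub_nonneg hsubX hsubZ hupX hupZ) n

/-! ### The theorem -/

/-- `e₁`, `Π`, `Π + 1` have nonnegative coefficients. [this work] -/
theorem coeff_ee_PiP_nonneg : (∀ m, 0 ≤ (ee 1 : MvPolynomial α ℤ).coeff m) ∧ (∀ m, 0 ≤ (PiP : MvPolynomial α ℤ).coeff m) ∧
    (∀ m, 0 ≤ (PiP + 1 : MvPolynomial α ℤ).coeff m) := by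
  have hP : ∀ m, 0 ≤ (PiP : MvPolynomial α ℤ).coeff m := fun m => by unfold PiP; exact coeff_gf_nonneg _ m
  refine ⟨fun m => by unfold ee; exact coeff_gf_nonneg _ m, hP, cw_add hP cw_one⟩

/-- The core case of the theorem: `∅ ∉ 𝒳, 𝒵`. [this work] -/
theorem coeff_M1_nonneg_core {𝒳 𝒵 : Finset (Finset α)} (h𝒳 : IsUpperSet (𝒳 : Set (Finset α))) (h𝒵 : IsUpperSet (𝒵 : Set (Finset α)))
    (hX0 : ∅ ∉ 𝒳) (hZ0 : ∅ ∉ 𝒵) : ∀ n, 0 ≤ (M1 𝒳 𝒵).coeff n := by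
  obtain ⟨he, hP, hP1⟩ := coeff_ee_PiP_nonneg (α := α)
  have hY0 : ∅ ∉ 𝒳 ∩ 𝒵 := fun h => hX0 (mem_inter.1 h).1
  have key : M1 𝒳 𝒵 = ee 1 * (PiP + 1) * (PiP * gf (𝒳 ∩ 𝒵) - gf 𝒳 * gf 𝒵 - gf (meets (loops 𝒳 𝒵)))
      + ee 1 * gf (meets (loops 𝒳 𝒵)) + PiP * (ee 1 * gf (meets (loops 𝒳 𝒵)) - (PiP - 1) * gf (singles (loops 𝒳 𝒵))) := by
    unfold M1
    rw [erase_eq_of_notMem hY0, erase_eq_of_notMem hX0, erase_eq_of_notMem hZ0, empPart_eq_empty hX0, empPart_eq_empty hZ0, gf_empty]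
    ring
  intro n
  rw [key]
  exact cw_add (cw_add (cw_mul (cw_mul he hP1) (coeff_harris_sub_meets_nonneg h𝒳 h𝒵 hX0 hZ0)) (cw_mul he (coeff_gf_nonneg _)))
    (cw_mul hP (coeff_countingLemma_nonneg _)) n

/-- The case `∅ ∈ 𝒳` (then `𝒳 = 2^V` and `M₁ = Π·(e₁·Z₊ − (Π−1)·W_{L_Z})`, weighted LYM through the loops of `𝒵`). [this work] -/
theorem coeff_M1_nonneg_univ {𝒵 : Finset (Finset α)} (h𝒵 : IsUpperSet (𝒵 : Set (Finset α))) :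
    ∀ n, 0 ≤ (M1 (univ.powerset : Finset (Finset α)) 𝒵).coeff n := by
  obtain ⟨he, hP, -⟩ := coeff_ee_PiP_nonneg (α := α)
  set L := loops (univ.powerset : Finset (Finset α)) 𝒵 with hLdef
  have hLZ : ∀ u ∈ L, ({u} : Finset α) ∈ 𝒵 := fun u hu => singleton_mem_right_of_mem_loops hu
  have hsub : meets L ⊆ 𝒵.erase ∅ := by
    intro S hS
    have hne : S ≠ ∅ := by
      obtain ⟨u, hu⟩ := (mem_filter.1 hS).2
      exact nonempty_iff_ne_empty.1 ⟨u, (mem_inter.1 hu).1⟩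
    exact mem_erase.2 ⟨hne, mem_of_mem_meets h𝒵 hLZ hS⟩
  have hint : (univ.powerset : Finset (Finset α)) ∩ 𝒵 = 𝒵 := inter_eq_right.2 fun S _ => mem_powerset.2 (subset_univ S)
  have hE : gf ((univ.powerset : Finset (Finset α)).erase ∅) = PiP - 1 := by rw [PiP_eq_gf_erase_add_one (α := α)]; ring
  have h0 : (∅ : Finset α) ∈ (univ.powerset : Finset (Finset α)) := mem_powerset.2 (empty_subset _)
  have key : M1 (univ.powerset : Finset (Finset α)) 𝒵 =
      PiP * (ee 1 * gf (𝒵.erase ∅ \ meets L) + (ee 1 * gf (meets L) - (PiP - 1) * gf (singles L))) := by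
    unfold M1
    rw [hint, hE, empPart_eq_singleton h0, gf_singleton_empty, ← hLdef, gf_eq_sdiff_add hsub]
    ring
  intro n
  rw [key]
  exact cw_mul hP (cw_add (cw_mul he (coeff_gf_nonneg _)) (coeff_countingLemma_nonneg _)) n

/-- **THEOREM (co-level 1, every ground set): `M₁(𝒳,𝒵) ∈ ℕ[s]` for every pair of up-sets `𝒳, 𝒵`** (memo g24 §3) — the complement-dual
of "`Ñ_{k−1}(K_X,K_Z) ∈ ℕ[r]` for every pair of complexes on `k` points", i.e. CTC_{k−1}(k) for every `k`; at the odds vector its value is the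
(TC) row of `ρ_{k−1} = μ(·|exactly one open)` for the slot "at least one of `k` open". [this work] -/
theorem coeff_M1_nonneg {𝒳 𝒵 : Finset (Finset α)} (h𝒳 : IsUpperSet (𝒳 : Set (Finset α))) (h𝒵 : IsUpperSet (𝒵 : Set (Finset α))) :
    ∀ n, 0 ≤ (M1 𝒳 𝒵).coeff n := by
  by_cases hX0 : ∅ ∈ 𝒳
  · rw [eq_univ_powerset_of_empty_mem h𝒳 hX0]; exact coeff_M1_nonneg_univ h𝒵
  by_cases hZ0 : ∅ ∈ 𝒵
  · rw [M1_comm, eq_univ_powerset_of_empty_mem h𝒵 hZ0]; exact coeff_M1_nonneg_univ h𝒳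
  exact coeff_M1_nonneg_core h𝒳 h𝒵 hX0 hZ0

/-- The same at the VALUE level: `M₁(𝒳,𝒵)(s) ≥ 0` at every `s ≥ 0`. [this work] -/
theorem eval_M1_nonneg {𝒳 𝒵 : Finset (Finset α)} (h𝒳 : IsUpperSet (𝒳 : Set (Finset α))) (h𝒵 : IsUpperSet (𝒵 : Set (Finset α)))
    (r : α → ℝ) (hr : ∀ i, 0 ≤ r i) : 0 ≤ eval₂ (Int.castRingHom ℝ) r (M1 𝒳 𝒵) := by
  have h := eval_le_of_coeff_le (P := (0 : MvPolynomial α ℤ)) (Q := M1 𝒳 𝒵) (fun m => by rw [coeff_zero]; exact coeff_M1_nonneg h𝒳 h𝒵 m) r hr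
  rwa [eval₂_zero] at h

end Summit.CriticalPhenomena.PercolationContinuityZ3.Theorems.SahiCTCForms
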